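/- Copyright: the b2b-balaban cell (near-miss cell 7), T⁴-continuum fan-out, lineage t4-ne7b-p1 (node U5c COUNT
member).  Released under the licence of the surrounding project. -/
import Summits.QuantumFields.BalabanUV.T4Continuum.Support.HistoryBankingAnchors
import Summits.QuantumFields.BalabanUV.T4Continuum.Support.HistoryRealiseWeak
import Summits.QuantumFields.BalabanUV.T4Continuum.Support.HistoryBankingJoinCover

/-!
# M5-1b (A3a) — THE MAXIMAL REALISATION OF A PEDIGREE: the recursive maximal domain `MDP`, the realised domains lie
inside it, and it is non-empty and TOUCH-connected from the last event on (owner module of row NE7b, lineage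
`t4-ne7b-p1` gen 43; re-open object (α), `SCOPE-alpha.md` v2.6, ruling R-OWNER-43-1 «THE FLAT ANCHOR LEDGER» (a);
PRE-POSITIONING ONLY)

Summits-side support leaf of the T⁴-continuum cell (rung (B)+1 on a FINITE torus only; NOT infinite volume, NOT the
mass gap, NOT the Clay statement; NOT a proof of the spine estimate NE7b, which is the cell's OWN estimate, NOT PRINTED
and NOT PROVED).  [folklore] finite combinatorics on `ℤᵈ` over the lineage's pedigree skeleton
`HistoryAdmissible.PGen` (birth ∕ renew ∕ join, `lastStep`, `Adm`), its memory-agnostic realisation predicate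
`HistoryRealiseWeak.RealisesW` (R-41-a), the orbit vocabulary of `HistoryRealise` (`orbit`, `orbit_succ`,
`orbit_mono`, `orbit_union`), the b02 lineage's index model (`B16SProfile.Sop`, `Sop_biUnion`, `Sop_nonempty`,
`B16OverhangN.faceConnected_Sop_of_touchConnected`, `B16MergeGeometry.touchConnected_of_faceConnected`) and the
lineage's `HistoryBankingJoinCover.touchConnected_union_of_touch`; nothing printed is asserted, no `def … : Prop`
fact of Bałaban's is minted, no cite-tagged hypothesis, zero `sorry`.  One `def` (`MDP`) names a finite subset of the
index model; it introduces no notion of Bałaban's.  B16 = [Balaban1989LargeFieldII] pp. 384–387 under audit; locators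
only.

WHY (ruling R-OWNER-43-1 (a), journal «RULING R-OWNER-43-1»).  The flat anchor ledger of M5-1b prices a live
structure's volume through its MAXIMAL realisation: the union of the orbits of its birth regions, which is determined by
the pedigree's birth tags alone (no existential domains), contains every realised domain ((G-join) is `⊆`), and — being
`≥` the realised volume while the per-cube cost is `Λ ≥ 1` — dominates M2-B's cost factor.  The anchor bound of the
ledger (`HistoryBankingAnchors.card_MD_le_flat`) needs each component's maximal domain at the lag time to be NON-EMPTY and
TOUCH-CONNECTED (the reference of b02's `card_closureIdx_le_decay` is `S` of it, which is then face-connected).  THIS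
FILE: §1 **`MDP L s P t`** — the maximal domain of the pedigree `P` at time `t`, by recursion (a birth contributes its
region's orbit once born; a renewal changes nothing; a join is the union), `MDP_succ` ∕ `MDP_add` (from the last event
on, the maximal domain is a LONE ORBIT: one `S` per step — no birth after `lastStep` under `Adm`), `MDP_eq_empty_of_lt`
(nothing before the root step); §2 **`subset_MDP_of_realisesW`** — a realised last-event domain lies in the maximal domain
at the last step, hence every current domain in the maximal domain at its time (`curDomain_subset_MDP`); §3
**`nonempty_touchConnected_MDP`** — for a realised pedigree, the maximal domain at every time `t ≥ lastStep` is
non-empty and touch-connected (births: face-connected regions; one `S` per step preserves it; joins: the partners' images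
at the join scale own a touching pair of cubes by the join clause, and lie inside the partners' maximal domains).

WHAT IS *NOT* DONE HERE.  The component bookkeeping along the pedigree (which sub-pedigrees are the components at an
intermediate time, their count `N(t)`, the young ∕ dead split of the births, the lagged anchor bound assembled in the
shape of `HistoryBankingFlatLedger.flat_total_le`'s hypothesis — A3b), and the END side (A3c: young images by M5-1a,
floors by `Gen.covers`, fees, the reading display).  HONEST: index-model bookkeeping; NE7b NOT proved; spine 0∕9.
HONEST DEPENDENCY (cell): continuum YM on T⁴ ⇐ BetaPertH ∧ nine spine estimates (0∕9 proved); BetaPertH ⇐ (D1) ∧ (D4)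
∧ CAP+tail.  This file changes none of it.
-/

open Finset
open Literature.MathematicalPhysics.QuantumFieldTheory.Balaban1983to89
open Literature.MathematicalPhysics.QuantumFieldTheory.Balaban1983to89.B13ScaleTransfer
open Literature.MathematicalPhysics.QuantumFieldTheory.Balaban1983to89.TreeLength
open Literature.MathematicalPhysics.QuantumFieldTheory.Balaban1983to89.B16SProfile
open Literature.MathematicalPhysics.QuantumFieldTheory.Balaban1983to89.B16MergeGeometry
open Literature.MathematicalPhysics.QuantumFieldTheory.Balaban1983to89.B16StoppingRule
open Literature.MathematicalPhysics.QuantumFieldTheory.Balaban1983to89.B16MergeHorizon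
open Literature.MathematicalPhysics.QuantumFieldTheory.Balaban1983to89.B16OverhangN
open Summit.QuantumFields.BalabanUV.T4Continuum.HistoryAdmissible
open Summit.QuantumFields.BalabanUV.T4Continuum.HistoryRealise
open Summit.QuantumFields.BalabanUV.T4Continuum.HistoryRealiseCells
open Summit.QuantumFields.BalabanUV.T4Continuum.HistoryRealiseWeak
open Summit.QuantumFields.BalabanUV.T4Continuum.HistoryBankingJoinCover

namespace Summit.QuantumFields.BalabanUV.T4Continuum.HistoryBankingPedigreeMax

noncomputable section

variable {d : ℕ}

/-! ## §1 The maximal domain of a pedigree -/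

section MaxDomain

variable (L : ℕ) (s : ℕ → ℕ)

/-- **THE MAXIMAL DOMAIN OF A PEDIGREE AT TIME `t`**: a birth region contributes its orbit `t − j` steps on once born
(`j ≤ t`), a renewal changes nothing (the renewed line is the `S`-image of the old one), a join is the union of the
partners' maximal domains (print's joined component lies INSIDE the union of the constituents' images, (1.84)).
[folklore] -/
def MDP : PGen (Pt d × Finset (Pt d)) → ℕ → Finset (Pt d)
  | .birth j _ zZ, t => if j ≤ t then orbit L s j zZ.2 (t - j) else ∅
  | .renew G _, t => MDP G t
  | .join X Y _, t => MDP X t ∪ MDP Y t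

variable {L s}

/-- the maximal domain of a birth once born [folklore] -/
theorem MDP_birth_of_le {j cls : ℕ} {zZ : Pt d × Finset (Pt d)} {t : ℕ} (h : j ≤ t) :
    MDP L s (.birth j cls zZ) t = orbit L s j zZ.2 (t - j) := by
  simp [MDP, h]

/-- a renewal changes nothing [folklore] -/
@[simp] theorem MDP_renew (G : PGen (Pt d × Finset (Pt d))) (h t : ℕ) : MDP L s (.renew G h) t = MDP L s G t := rfl

/-- a join is the union [folklore] -/
@[simp] theorem MDP_join (X Y : PGen (Pt d × Finset (Pt d))) (sj t : ℕ) :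
    MDP L s (.join X Y sj) t = MDP L s X t ∪ MDP L s Y t := rfl

/-- **NOTHING BEFORE THE ROOT STEP**: `t < rootStep` gives an empty maximal domain. [folklore] -/
theorem MDP_eq_empty_of_lt : ∀ (P : PGen (Pt d × Finset (Pt d))) {t : ℕ}, t < P.rootStep → MDP L s P t = ∅
  | .birth j _ _, t, h => by
      simp only [PGen.rootStep] at h
      simp [MDP, Nat.not_le.2 h]
  | .renew G _, t, h => MDP_eq_empty_of_lt G h
  | .join X Y _, t, h => by
      simp only [PGen.rootStep, lt_min_iff] at h
      rw [MDP_join, MDP_eq_empty_of_lt X h.1, MDP_eq_empty_of_lt Y h.2, Finset.union_empty]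

/-- `S` distributes over a binary union (from b02's `Sop_biUnion`). [folklore] -/
theorem Sop_union (q : ℕ) (A B : Finset (Pt d)) : Sop q (A ∪ B) = Sop q A ∪ Sop q B := by
  have h : A ∪ B = ({A, B} : Finset (Finset (Pt d))).biUnion id := by simp
  rw [h, Sop_biUnion]
  simp

/-- **ONE `S` PER STEP FROM THE LAST EVENT ON**: under `Adm K` (every birth is dated at or before the last event), for
`t ≥ lastStep`, `MDP P (t+1) = S_t (MDP P t)`. [folklore] -/
theorem MDP_succ : ∀ (P : PGen (Pt d × Finset (Pt d))) {K t : ℕ}, P.Adm K → P.lastStep ≤ t →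
    MDP L s P (t + 1) = Sop (ratio L s t) (MDP L s P t)
  | .birth j cls zZ, K, t, _, ht => by
      simp only [PGen.lastStep] at ht
      rw [MDP_birth_of_le (by omega), MDP_birth_of_le ht]
      exact HistoryBankingAnchors.orbit_step ht zZ.2
  | .renew G h, K, t, hA, ht => by
      simp only [PGen.Adm] at hA
      simp only [PGen.lastStep] at ht
      rw [MDP_renew, MDP_renew]
      exact MDP_succ G hA.1 (by omega)
  | .join X Y sj, K, t, hA, ht => by
      simp only [PGen.Adm] at hA
      simp only [PGen.lastStep] at ht
      rw [MDP_join, MDP_join, Sop_union, MDP_succ X hA.1 (by omega), MDP_succ Y hA.2.1 (by omega)]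

/-- **A LONE ORBIT FROM THE LAST EVENT ON**: for `t ≥ lastStep`, `MDP P (t + l) = orbit L s t (MDP P t) l`.
[folklore] -/
theorem MDP_add (P : PGen (Pt d × Finset (Pt d))) {K t : ℕ} (hA : P.Adm K) (ht : P.lastStep ≤ t) :
    ∀ l, MDP L s P (t + l) = orbit L s t (MDP L s P t) l
  | 0 => by simp
  | l + 1 => by
      rw [← Nat.add_assoc, MDP_succ P hA (by omega), MDP_add P hA ht l, orbit_succ, ratio_shift]

/-- subtractive form: `lastStep ≤ t ≤ m` gives `MDP P m = orbit L s t (MDP P t) (m − t)` [folklore] -/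
theorem MDP_eq_orbit (P : PGen (Pt d × Finset (Pt d))) {K t m : ℕ} (hA : P.Adm K) (ht : P.lastStep ≤ t)
    (htm : t ≤ m) : MDP L s P m = orbit L s t (MDP L s P t) (m - t) := by
  rw [← MDP_add P hA ht (m - t), Nat.add_sub_cancel' htm]

end MaxDomain

/-! ## §2 Realised domains lie inside the maximal domain -/

section Realised

variable {L : ℕ} {s R : ℕ → ℕ}

/-- **THE REALISED LAST-EVENT DOMAIN LIES IN THE MAXIMAL DOMAIN AT THE LAST STEP** — births `=`, renewals `=` the
image of a subset, joins `⊆` the union of the partners' images (the join clause of `RealisesW`). [folklore] -/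
theorem subset_MDP_of_realisesW :
    ∀ (P : PGen (Pt d × Finset (Pt d))) (Z : Finset (Pt d)), RealisesW L s R P Z → Z ⊆ MDP L s P P.lastStep
  | .birth j cls zZ, Z, hP => by
      obtain ⟨hZ, -, -, -⟩ := hP
      simp only [PGen.lastStep]
      rw [MDP_birth_of_le le_rfl, Nat.sub_self, orbit_zero, hZ]
  | .renew G h, Z, hP => by
      obtain ⟨ZG, hG, hlt, -, -, hZ⟩ := hP
      have hAG : G.Adm G.lastStep := adm_of_realisesW G ZG hG le_rfl
      simp only [PGen.lastStep]
      rw [hZ, MDP_renew, MDP_eq_orbit G hAG le_rfl (by omega : G.lastStep ≤ h + 1)]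
      exact orbit_mono L s _ (subset_MDP_of_realisesW G ZG hG) _
  | .join X Y sj, Z, hP => by
      obtain ⟨ZX, ZY, hX, hY, hXs, hYs, -, -, -, hZ⟩ := hP
      have hAX : X.Adm X.lastStep := adm_of_realisesW X ZX hX le_rfl
      have hAY : Y.Adm Y.lastStep := adm_of_realisesW Y ZY hY le_rfl
      simp only [PGen.lastStep]
      rw [MDP_join, MDP_eq_orbit X hAX le_rfl hXs, MDP_eq_orbit Y hAY le_rfl hYs]
      exact hZ.trans (Finset.union_subset_union (orbit_mono L s _ (subset_MDP_of_realisesW X ZX hX) _)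
        (orbit_mono L s _ (subset_MDP_of_realisesW Y ZY hY) _))

/-- **EVERY CURRENT DOMAIN LIES IN THE MAXIMAL DOMAIN AT ITS TIME**: for `m ≥ lastStep`,
`curDomain L s P Z m ⊆ MDP L s P m`. [folklore] -/
theorem curDomain_subset_MDP {P : PGen (Pt d × Finset (Pt d))} {Z : Finset (Pt d)} (hP : RealisesW L s R P Z)
    {m : ℕ} (hm : P.lastStep ≤ m) : curDomain L s P Z m ⊆ MDP L s P m := by
  unfold curDomain
  rw [MDP_eq_orbit P (adm_of_realisesW P Z hP le_rfl) le_rfl hm]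
  exact orbit_mono L s _ (subset_MDP_of_realisesW P Z hP) _

/-- the image, `l` steps on, of a realised last-event domain lies in the maximal domain [folklore] -/
theorem orbit_subset_MDP {P : PGen (Pt d × Finset (Pt d))} {Z : Finset (Pt d)} (hP : RealisesW L s R P Z)
    {m : ℕ} (hm : P.lastStep ≤ m) : orbit L s P.lastStep Z (m - P.lastStep) ⊆ MDP L s P m :=
  curDomain_subset_MDP hP hm

end Realised

/-! ## §3 From the last event on, the maximal domain is non-empty and touch-connected -/

section Connected

variable {L : ℕ} {s R : ℕ → ℕ}

/-- one `S` keeps a set non-empty and touch-connected [folklore] -/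
theorem nonempty_touchConnected_Sop {q : ℕ} (hq : 0 < q) {A : Finset (Pt d)} (hA : A.Nonempty)
    (hAc : TouchConnected A) : (Sop q A).Nonempty ∧ TouchConnected (Sop q A) :=
  ⟨Sop_nonempty q hA, touchConnected_of_faceConnected (faceConnected_Sop_of_touchConnected hq hAc)⟩

/-- propagation along the lone orbit: if the maximal domain is non-empty and touch-connected at some `t ≥ lastStep`, it
stays so (`L ≥ 1`). [folklore] -/
theorem nonempty_touchConnected_MDP_of_le (hL : 1 ≤ L) (P : PGen (Pt d × Finset (Pt d))) {K t : ℕ} (hA : P.Adm K)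
    (ht : P.lastStep ≤ t) (h : (MDP L s P t).Nonempty ∧ TouchConnected (MDP L s P t)) :
    ∀ {m : ℕ}, t ≤ m → (MDP L s P m).Nonempty ∧ TouchConnected (MDP L s P m) := by
  intro m htm
  induction m, htm using Nat.le_induction with
  | base => exact h
  | succ m htm ih =>
      rw [MDP_succ P hA (by omega)]
      exact nonempty_touchConnected_Sop (ratio_pos (by omega) s m) ih.1 ih.2

/-- **NON-EMPTY AND TOUCH-CONNECTED FROM THE LAST EVENT ON.**  For a pedigree realised along a flow with `L ≥ 1`, the
maximal domain at every time `t ≥ lastStep` is non-empty and touch-connected: a birth region is face-connected and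
owns its anchor cube; a renewal continues the lone orbit; at a join the partners' maximal domains at the join scale are
touch-connected (induction, continued along their lone orbits) and own the touching pair of cubes of the join clause
(the partners' realised images lie inside them, §2). [folklore] -/
theorem nonempty_touchConnected_MDP (hL : 1 ≤ L) :
    ∀ (P : PGen (Pt d × Finset (Pt d))) (Z : Finset (Pt d)), RealisesW L s R P Z →
      ∀ {t : ℕ}, P.lastStep ≤ t → (MDP L s P t).Nonempty ∧ TouchConnected (MDP L s P t)
  | .birth j cls zZ, Z, hP, t, ht => by
      obtain ⟨hZ, hc, hZc, -⟩ := hP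
      have hA : (PGen.birth j cls zZ).Adm j := le_rfl
      refine nonempty_touchConnected_MDP_of_le hL _ hA le_rfl ?_ ht
      simp only [PGen.lastStep]
      rw [MDP_birth_of_le le_rfl, Nat.sub_self, orbit_zero, hZ]
      exact ⟨⟨zZ.1, hc⟩, touchConnected_of_faceConnected hZc⟩
  | .renew G h, Z, hP, t, ht => by
      obtain ⟨ZG, hG, hlt, -, -, -⟩ := hP
      simp only [PGen.lastStep] at ht
      rw [MDP_renew]
      exact nonempty_touchConnected_MDP hL G ZG hG (by omega)
  | .join X Y sj, Z, hP, t, ht => by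
      obtain ⟨ZX, ZY, hX, hY, hXs, hYs, -, -, ⟨a, ha, c, hc, hac⟩, -⟩ := hP
      have hA : (PGen.join X Y sj).Adm sj :=
        ⟨adm_of_realisesW X ZX hX hXs, adm_of_realisesW Y ZY hY hYs, hXs, hYs, le_rfl⟩
      refine nonempty_touchConnected_MDP_of_le hL _ hA le_rfl ?_ ht
      have hXc := nonempty_touchConnected_MDP hL X ZX hX hXs
      have hYc := nonempty_touchConnected_MDP hL Y ZY hY hYs
      rw [MDP_join]
      exact ⟨hXc.1.mono Finset.subset_union_left,
        touchConnected_union_of_touch hXc.2 hYc.2 (orbit_subset_MDP hX hXs ha) (orbit_subset_MDP hY hYs hc) hac⟩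

end Connected

/-! ## §4 Sanity: the unit pedigree -/

/-- The one-cube birth of `HistoryRealise.Sanity.unit` has maximal domain `{0}` at its birth step (`d = 1`, any flow).
[folklore] -/
theorem sanity_unit (L : ℕ) (s : ℕ → ℕ) :
    MDP L s HistoryRealise.Sanity.unit 0 = ({B16MergeGeometry.OneDim.pt 0} : Finset (Pt 1)) := by
  simp [HistoryRealise.Sanity.unit, MDP]

end

end Summit.QuantumFields.BalabanUV.T4Continuum.HistoryBankingPedigreeMax
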